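import Literature.NumberTheory.EllipticCurves.IntSeriesIdentityPrinciple
import Literature.NumberTheory.EllipticCurves.PAdicOneVariableCharacterSupport
import Literature.NumberTheory.EllipticCurves.PAdicDistributionAdditivity
import Literature.NumberTheory.EllipticCurves.PAdicOneVariableTraceCriterionComplex
import Literature.NumberTheory.EllipticCurves.PAdicLFunctionInterpolationProofs
import HarnessLib

/-!
# The identity principle for bounded `p`-adic power series at the TORSION POINTS `ζ − 1`:
# an element of `𝒪_{ℂ_p}⟦T⟧` vanishing at `ζ − 1` for every `p`-power root of unity `ζ` of large order is `0`
# (one and two variables; all PROVED)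

Topic `Literature/NumberTheory/EllipticCurves`, namespace `Literature.NumberTheory.EllipticCurves`
(grouping sub-namespaces `BoundedDistribution`, `IntSeries`). THEOREMS ONLY: no definition, no named
fact, no `sorry`, no `instance`.

WHY. The tree's identity principle `IntSeries.eq_zero_of_infinite_zeros` (Gouvêa Cor. 5.6.3–5.6.4,
Strassman for the rescaled series) needs infinitely many zeros inside a CLOSED disc `‖x‖ ≤ ‖ϖ‖ < 1`. The
torsion points `ζ − 1`, `ζ ∈ μ_{p^∞}`, accumulate at the BOUNDARY of the open unit disc
(`‖ζ − 1‖ = p^{−1/φ(pⁿ)} → 1`): only finitely many of them lie in any closed subdisc, so that principle is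
silent on them — and a bounded series CAN have infinitely many zeros in the open disc. Nevertheless a
non-zero bounded series cannot vanish at all torsion points of large order: by de Shalit's (1)/(8)
(`hasSum_charSum_invAmice₁`) the value `P(ζ − 1)` is the character sum `∫ ζ^x dD_P` of the bounded
distribution `D_P = invAmice₁ p P` on `ℤ_p`; if these vanish for all PRIMITIVE `ζ` of every level
`n > n₀`, Fourier inversion on `ℤ/p^{n+1}` (`fourier_inversion`) shows that the `p` masses of `D_P` above
each level-`n` class are EQUAL (`p · D_P(a + p^{n+1}ℤ_p) = D_P(ā + pⁿℤ_p)`, `n ≥ n₀`), hence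
`D_P(ā + p^{n₀}ℤ_p) = p^k · D_P(a + p^{n₀+k}ℤ_p)` has norm `≤ ‖p‖^k · C → 0`: BOUNDEDNESS (not
zero-counting) forces `D_P = 0`, and `P = 0` by the inversion theorem `[S^i]P = ∫ (x choose i) dD_P`. This
is the `p`-adic-measure half of the classical dictionary (Washington §12.2; de Shalit I.3.1–3.3), read as
a uniqueness statement. The two-variable forms follow fibrewise exactly as in
`IntSeriesIdentityPrinciple` §3–§4 (lines `T₁ = c`, transposition).

USE (cell bsd-print-cf2, crux `PrintCf2.SplitBadTwoRankOneOfFacts`, print leaf 24720 under the `j = 0`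
option): on de Shalit's two-variable frame restricted to the infinity types `(−m, 0)` (`IsKatzMeasure₂₀`),
the second interpolation coordinate `r(γ₂) − 1` (`γ₂` in the inertia group at `v̄`, where the `p`-adic
weight is `0`) runs over torsion points only; the rigidity of that frame ("two solutions generate the same
ideal") therefore needs THIS principle in the second variable and the closed-disc principle in the first.

## Contents (all proved)

* §1 (any complete non-archimedean field `𝕜` over `ℚ_p`, any bounded distribution `D` on `ℤ_p`):
  `BoundedDistribution.natCast_mul_μ_succ_eq_of_charSum_eq_zero` (vanishing of the level-`(n+1)` character
  sums at the PRIMITIVE `p^{n+1}`-th roots ⟹ `p · D(a) = D(ā)`), `…natCast_pow_mul_μ_add_eq_of_charSum_eq_zero`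
  (iterated), `…μ_eq_zero_of_le` (downward additivity), ★ `…μ_eq_zero_of_charSum_primitive_eq_zero`
  (all masses vanish), ★ `eq_zero_of_hasSum_torsion_eq_zero` (a bounded `P ∈ 𝕜⟦S⟧` with
  `Σ_k [S^k]P (ζ − 1)^k = 0` for every primitive `pⁿ`-th root `ζ`, `n > n₀`, is `0`).
* §2 (`𝒪_{ℂ_p}⟦T⟧`, the receptacle `IntSeries.HasValueAt`): ★★ `IntSeries.eq_zero_of_forall_hasValueAt_torsion_zero`,
  `IntSeries.eq_of_forall_hasValueAt_torsion_eq`.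
* §3 (`𝒪_{ℂ_p}⟦T₁⟧⟦T₂⟧`, `IntSeries.HasValueAt₂`): `IntSeries.lineSubst_eq_zero_of_torsion_zeros`,
  ★★ `IntSeries.eq_zero_of_zeros₂_fibred_torsion` (first coordinate: an infinite subset of a closed disc;
  second: the torsion points of large order, on each line), `IntSeries.eq_of_hasValueAt₂_eq_fibred_torsion`
  (agreement form), `IntSeries.eq_zero_of_zeros₂_torsion_fst` (the transposed orientation),
  `IntSeries.eq_zero_of_zeros₂_torsion_torsion` (both coordinates torsion).

## References

* [Washington1997] L. C. Washington, *Introduction to Cyclotomic Fields*, GTM 83, §12.2 (measures on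
  `ℤ_p` and power series; `∫ ζ^x dμ = P_μ(ζ − 1)`), Lemma 4.7 (orthogonality on `ℤ/pⁿ`), §7.2.
* [deShalit1987] E. de Shalit, *Iwasawa theory of elliptic curves with complex multiplication* (1987),
  I.3.1 (1) (p. 16), I.3.3 (7)–(8) (p. 17–18); II.4.17 (51)–(54) (p. 77–78) (lines of `G(χ; T₁, T₂)`).
* [Gouvea1993PadicNumbers] F. Q. Gouvêa, *p-adic Numbers*, §5.6 Cor. 5.6.3–5.6.4 (the closed-disc
  principle this file complements).
-/

noncomputable section

open Filter Topology Finset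

namespace Literature.NumberTheory.EllipticCurves

variable {p : ℕ} [Fact p.Prime]

/-! ### §1. Bounded distributions on `ℤ_p` killed by the primitive characters of large level -/

namespace BoundedDistribution

variable {𝕜 : Type*} [NormedField 𝕜] [NormedAlgebra ℚ_[p] 𝕜]
variable (D : BoundedDistribution (ProfiniteTower.padicInt p) 𝕜)

/-- **Equal masses above a class.** If the level-`(n+1)` character sums `Σ_b D(b) (ζ^j)^b` of `D` vanish
for every `j` prime to `p` (`ζ` a primitive `p^{n+1}`-th root of unity: these are the PRIMITIVE characters
of `ℤ/p^{n+1}`), then `p · D(a + p^{n+1}ℤ_p) = D(ā + pⁿℤ_p)` for every class `a` (Fourier inversion at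
the two levels; the non-primitive characters `ζ^{pi}` are read at level `n` by `charSum_succ`).
[cite: Washington1997, Lemma 4.7 and §12.2] [cite: deShalit1987, I.3.1 (1) (p. 16)] -/
theorem natCast_mul_μ_succ_eq_of_charSum_eq_zero (n : ℕ) {ζ : 𝕜} (hζ : IsPrimitiveRoot ζ (p ^ (n + 1)))
    (h : ∀ j : ℕ, ¬ p ∣ j → D.charSum (n + 1) (ζ ^ j) = 0) (a : ZMod (p ^ (n + 1))) :
    (p : 𝕜) * D.μ (n + 1) a = D.μ n (ZMod.castHom (pow_dvd_pow p n.le_succ) (ZMod (p ^ n)) a) := by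
  have hp : p.Prime := Fact.out
  haveI : CharZero 𝕜 := charZero_of_normedAlgebra_padic p 𝕜
  haveI : NeZero (p ^ (n + 1)) := ⟨pow_ne_zero _ hp.ne_zero⟩
  haveI : NeZero (p ^ n) := ⟨pow_ne_zero _ hp.ne_zero⟩
  set ā : ZMod (p ^ n) := ZMod.castHom (pow_dvd_pow p n.le_succ) (ZMod (p ^ n)) a with hā
  -- `η = ζ^p`, a primitive `pⁿ`-th root of unity
  have hη : IsPrimitiveRoot (ζ ^ p) (p ^ n) := hζ.pow (pow_pos hp.pos _) (pow_succ' p n)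
  -- Fourier inversion at the two levels, inner sums as character sums
  have h1 := fourier_inversion hζ (D.μ (n + 1)) a
  have h2 := fourier_inversion hη (D.μ n) ā
  simp_rw [← charSum_def] at h1 h2
  -- `ā.val ≡ a.val (mod pⁿ)`
  have hāval : ā.val = a.val % p ^ n := by
    rw [hā, ZMod.castHom_apply, ZMod.cast_eq_val, ZMod.val_natCast]
  have hmod : p * a.val ≡ p * ā.val [MOD p ^ (n + 1)] := by
    have hmod' : a.val ≡ ā.val [MOD p ^ n] := by
      rw [hāval]
      exact (Nat.mod_modEq a.val (p ^ n)).symm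
    have := Nat.ModEq.mul_left' p hmod'
    rwa [← pow_succ'] at this
  -- the two left-hand sides agree
  have key : ∑ j ∈ range (p ^ (n + 1)), ζ⁻¹ ^ (j * a.val) * D.charSum (n + 1) (ζ ^ j) =
      ∑ i ∈ range (p ^ n), (ζ ^ p)⁻¹ ^ (i * ā.val) * D.charSum n ((ζ ^ p) ^ i) := by
    rw [← sum_filter_add_sum_filter_not (range (p ^ (n + 1))) (fun j ↦ p ∣ j)]
    have hzero : ∑ j ∈ (range (p ^ (n + 1))).filter (fun j ↦ ¬ p ∣ j),
        ζ⁻¹ ^ (j * a.val) * D.charSum (n + 1) (ζ ^ j) = 0 :=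
      sum_eq_zero fun j hj ↦ by rw [h j (mem_filter.mp hj).2, mul_zero]
    rw [hzero, add_zero]
    have himage : (range (p ^ (n + 1))).filter (fun j ↦ p ∣ j) = (range (p ^ n)).image (fun i ↦ p * i) := by
      ext j
      simp only [mem_filter, mem_range, mem_image]
      constructor
      · rintro ⟨hj, i, rfl⟩
        refine ⟨i, ?_, rfl⟩
        rw [pow_succ'] at hj
        exact Nat.lt_of_mul_lt_mul_left hj
      · rintro ⟨i, hi, rfl⟩
        refine ⟨?_, dvd_mul_right p i⟩
        rw [pow_succ']
        exact Nat.mul_lt_mul_of_pos_left hi hp.pos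
    rw [himage, sum_image (fun i _ i' _ hii' ↦ Nat.eq_of_mul_eq_mul_left hp.pos hii')]
    refine sum_congr rfl fun i _ ↦ ?_
    have hpow : ζ ^ (p * i) = (ζ ^ p) ^ i := pow_mul ζ p i
    have hηi : ((ζ ^ p) ^ i) ^ p ^ n = 1 := by
      rw [← pow_mul, mul_comm i, pow_mul, hη.pow_eq_one, one_pow]
    rw [hpow, D.charSum_succ n hηi]
    congr 1
    -- `ζ⁻¹ ^ (p i · a.val) = (ζ^p)⁻¹ ^ (i · ā.val)`
    have hζinv : ζ⁻¹ ^ p ^ (n + 1) = 1 := by rw [inv_pow, hζ.pow_eq_one, inv_one]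
    rw [← inv_pow, ← pow_mul, pow_eq_pow_mod (p * i * a.val) hζinv,
      pow_eq_pow_mod (p * (i * ā.val)) hζinv]
    congr 1
    have h3 : p * i * a.val = i * (p * a.val) := by ring
    have h4 : p * (i * ā.val) = i * (p * ā.val) := by ring
    rw [h3, h4]
    exact Nat.ModEq.mul_left i hmod
  rw [key, h2] at h1
  -- `pⁿ · D(ā) = p^{n+1} · D(a)`
  have hpn : ((p ^ n : ℕ) : 𝕜) ≠ 0 := Nat.cast_ne_zero.mpr (pow_ne_zero _ hp.ne_zero)
  have h5 : ((p ^ n : ℕ) : 𝕜) * ((p : 𝕜) * D.μ (n + 1) a) = ((p ^ n : ℕ) : 𝕜) * D.μ n ā := by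
    rw [h1, ← mul_assoc]
    congr 1
    push_cast
    ring
  exact mul_left_cancel₀ hpn h5

/-- **Iterated**: if the character sums of `D` vanish at every primitive `pⁿ`-th root of unity of every
level `n > n₀` (and `𝕜` contains primitive roots of all `p`-power orders), then
`p^k · D(a + p^{n₀+k}ℤ_p) = D(ā + p^{n₀}ℤ_p)`. [cite: Washington1997, §12.2] [cite: deShalit1987, I.3.1 (1) (p. 16)] -/
theorem natCast_pow_mul_μ_add_eq_of_charSum_eq_zero (n₀ : ℕ)
    (hζ : ∀ n : ℕ, ∃ ζ : 𝕜, IsPrimitiveRoot ζ (p ^ (n + 1)))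
    (h : ∀ (n : ℕ) (ε : 𝕜), n₀ < n → IsPrimitiveRoot ε (p ^ n) → D.charSum n ε = 0)
    (k : ℕ) (a : ZMod (p ^ (n₀ + k))) :
    (p : 𝕜) ^ k * D.μ (n₀ + k) a =
      D.μ n₀ (ZMod.castHom (pow_dvd_pow p (Nat.le_add_right n₀ k)) (ZMod (p ^ n₀)) a) := by
  have hp : p.Prime := Fact.out
  induction k with
  | zero =>
    rw [pow_zero, one_mul]
    exact congrArg (D.μ n₀) (RingHom.congr_fun (ZMod.castHom_self (n := p ^ n₀)).symm a)
  | succ k ih =>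
    obtain ⟨ζ, hζ'⟩ := hζ (n₀ + k)
    have hstep : (p : 𝕜) * D.μ (n₀ + (k + 1)) a =
        D.μ (n₀ + k) (ZMod.castHom (pow_dvd_pow p (n₀ + k).le_succ) (ZMod (p ^ (n₀ + k))) a) :=
      D.natCast_mul_μ_succ_eq_of_charSum_eq_zero (n₀ + k) hζ' (fun j hj ↦
        h (n₀ + k + 1) (ζ ^ j) (by omega)
          (hζ'.pow_of_coprime j ((hp.coprime_iff_not_dvd.mpr hj).symm.pow_right (n₀ + k + 1)))) a
    rw [pow_succ, mul_assoc, hstep, ih]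
    exact congrArg (D.μ n₀) (RingHom.congr_fun
      (ZMod.castHom_comp (pow_dvd_pow p (Nat.le_add_right n₀ k)) (pow_dvd_pow p (n₀ + k).le_succ)) a)

omit [NormedAlgebra ℚ_[p] 𝕜] in
/-- **Downward additivity**: if all level-`(n + d)` masses of `D` vanish, so do all level-`n` masses
(the distribution relation). [cite: deShalit1987, I.3.1 (p. 16)] -/
theorem μ_eq_zero_of_le (d : ℕ) : ∀ n : ℕ, (∀ b, D.μ (n + d) b = 0) → ∀ a, D.μ n a = 0 := by
  induction d with
  | zero => exact fun n h a ↦ h a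
  | succ d ih =>
    intro n h a
    refine ih n (fun b ↦ ?_) a
    rw [← D.sum_fiber (n + d) b]
    exact sum_eq_zero fun c _ ↦ h c

/-- **A bounded distribution on `ℤ_p` killed by every primitive character of every level `> n₀` is
zero** (masses at all levels): `D(ā + p^{n₀}ℤ_p) = p^k · D(a + p^{n₀+k}ℤ_p)` has norm `≤ ‖p‖^k · C → 0`,
then the levels above `n₀` by the equal-masses relation and the levels below by additivity. The
boundedness of `D` is essential (Haar "measure" has all non-trivial character sums zero).
[cite: Washington1997, §12.2] [cite: deShalit1987, I.3.1 (1), I.3.3 (8) (p. 16–18)] -/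
theorem μ_eq_zero_of_charSum_primitive_eq_zero (n₀ : ℕ)
    (hζ : ∀ n : ℕ, ∃ ζ : 𝕜, IsPrimitiveRoot ζ (p ^ (n + 1)))
    (h : ∀ (n : ℕ) (ε : 𝕜), n₀ < n → IsPrimitiveRoot ε (p ^ n) → D.charSum n ε = 0)
    (n : ℕ) (a : ZMod (p ^ n)) : D.μ n a = 0 := by
  have hp : p.Prime := Fact.out
  haveI : CharZero 𝕜 := charZero_of_normedAlgebra_padic p 𝕜
  -- `‖(p : 𝕜)‖ < 1`
  have hnp : ‖(p : 𝕜)‖ < 1 := by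
    rw [← map_natCast (algebraMap ℚ_[p] 𝕜) p, norm_algebraMap']
    exact Padic.norm_p_lt_one
  -- level `n₀`
  have h0 : ∀ b : ZMod (p ^ n₀), D.μ n₀ b = 0 := by
    intro b
    haveI : NeZero (p ^ n₀) := ⟨pow_ne_zero _ hp.ne_zero⟩
    have hbound : ∀ k : ℕ, ‖D.μ n₀ b‖ ≤ ‖(p : 𝕜)‖ ^ k * D.bound := by
      intro k
      haveI : NeZero (p ^ (n₀ + k)) := ⟨pow_ne_zero _ hp.ne_zero⟩
      -- lift `b` to level `n₀ + k`
      set a : ZMod (p ^ (n₀ + k)) := (b.val : ZMod (p ^ (n₀ + k))) with ha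
      have hab : ZMod.castHom (pow_dvd_pow p (Nat.le_add_right n₀ k)) (ZMod (p ^ n₀)) a = b := by
        rw [ha, map_natCast, ZMod.natCast_zmod_val]
      have hk := D.natCast_pow_mul_μ_add_eq_of_charSum_eq_zero n₀ hζ h k a
      rw [hab] at hk
      rw [← hk, norm_mul, norm_pow]
      exact mul_le_mul_of_nonneg_left (D.norm_le _ _) (pow_nonneg (norm_nonneg _) _)
    have ht : Tendsto (fun k : ℕ ↦ ‖(p : 𝕜)‖ ^ k * D.bound) atTop (𝓝 0) := by
      simpa using (tendsto_pow_atTop_nhds_zero_of_lt_one (norm_nonneg _) hnp).mul_const D.bound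
    exact norm_le_zero_iff.mp (ge_of_tendsto' ht hbound)
  rcases le_or_gt n n₀ with hn | hn
  · -- below `n₀`: additivity
    obtain ⟨d, rfl⟩ := Nat.exists_eq_add_of_le hn
    exact D.μ_eq_zero_of_le d n h0 a
  · -- above `n₀`: `p^k · D(a) = D(ā) = 0`
    obtain ⟨k, rfl⟩ := Nat.exists_eq_add_of_lt hn
    have hk := D.natCast_pow_mul_μ_add_eq_of_charSum_eq_zero n₀ hζ h (k + 1) a
    rw [h0] at hk
    have hpk : (p : 𝕜) ^ (k + 1) ≠ 0 := pow_ne_zero _ (Nat.cast_ne_zero.mpr hp.ne_zero)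
    exact (mul_eq_zero.mp hk).resolve_left hpk

end BoundedDistribution

section Series

variable {𝕜 : Type*} [NormedField 𝕜] [NormedAlgebra ℚ_[p] 𝕜] [IsUltrametricDist 𝕜] [CompleteSpace 𝕜]

/-- **The torsion-point identity principle for bounded series over `𝕜`**: a power series `P ∈ 𝕜⟦S⟧` with
bounded coefficients such that `Σ_k [S^k]P · (ζ − 1)^k = 0` for every primitive `pⁿ`-th root of unity
`ζ ∈ 𝕜` of every level `n > n₀` is `0` — the values are the character sums of `D_P = invAmice₁ p P`
(`charSum_invAmice₁_eq_tsum`), which therefore vanishes, and `[S^i]P = ∫ (x choose i) dD_P = 0`.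
(`𝕜` is assumed to contain primitive roots of unity of all `p`-power orders, e.g. `𝕜 = ℂ_p`.)
[cite: Washington1997, §12.2] [cite: deShalit1987, I.3.1 (1), I.3.3 (8) (p. 16–18)] -/
theorem eq_zero_of_hasSum_torsion_eq_zero {P : PowerSeries 𝕜} {C : ℝ}
    (hC : ∀ k, ‖PowerSeries.coeff k P‖ ≤ C) (n₀ : ℕ)
    (hζ : ∀ n : ℕ, ∃ ζ : 𝕜, IsPrimitiveRoot ζ (p ^ (n + 1)))
    (h : ∀ (n : ℕ) (ζ : 𝕜), n₀ < n → IsPrimitiveRoot ζ (p ^ n) →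
      HasSum (fun k : ℕ ↦ PowerSeries.coeff k P * (ζ - 1) ^ k) 0) :
    P = 0 := by
  have hμ : ∀ n a, (invAmice₁ p P hC).μ n a = 0 :=
    BoundedDistribution.μ_eq_zero_of_charSum_primitive_eq_zero (p := p) (invAmice₁ p P hC) n₀ hζ
      fun n ε hn hε ↦ by
        rw [charSum_invAmice₁_eq_tsum hC n hε.pow_eq_one, (h n ε hn hε).tsum_eq]
  ext i
  rw [map_zero, ← integral_invAmice₁_mahlerFun₁ (p := p) hC i]
  exact (invAmice₁ p P hC).integral_eq_zero_of_μ_eq_zero hμ _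

end Series

/-! ### §2. One variable over `𝒪_{ℂ_p}`: the receptacle `IntSeries.HasValueAt` -/

namespace IntSeries

/-- **The torsion-point identity principle for `𝒪_{ℂ_p}⟦T⟧`, zeros form.** If `Q(ζ − 1) = 0` for every
primitive `pⁿ`-th root of unity `ζ ∈ ℂ_p` of every level `n > n₀`, then `Q = 0`. (The points `ζ − 1` are
NOT confined to a closed subdisc of the open unit disc — this is not a case of
`IntSeries.eq_zero_of_infinite_zeros`; the proof is by `p`-adic Fourier theory on `ℤ_p`,
`eq_zero_of_hasSum_torsion_eq_zero`.) [cite: Washington1997, §12.2] [cite: deShalit1987, I.3.1 (1), I.3.3 (8) (p. 16–18)] -/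
theorem eq_zero_of_forall_hasValueAt_torsion_zero {Q : PowerSeries (PadicComplexInt p)} (n₀ : ℕ)
    (h : ∀ (n : ℕ) (ζ : ℂ_[p]), n₀ < n → IsPrimitiveRoot ζ (p ^ n) → IntSeries.HasValueAt Q (ζ - 1) 0) :
    Q = 0 := by
  set P : PowerSeries ℂ_[p] :=
    PowerSeries.mk fun k ↦ ((PowerSeries.coeff k Q : PadicComplexInt p) : ℂ_[p]) with hP
  have hC : ∀ k, ‖PowerSeries.coeff k P‖ ≤ 1 := fun k ↦ by
    rw [hP, PowerSeries.coeff_mk]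
    exact norm_coe_padicComplexInt_le_one _
  have hP0 : P = 0 :=
    eq_zero_of_hasSum_torsion_eq_zero hC n₀ (PadicComplex.exists_isPrimitiveRoot_pow (p := p))
      fun n ζ hn hζ ↦ by
        have hv := h n ζ hn hζ
        unfold IntSeries.HasValueAt at hv
        simpa only [hP, PowerSeries.coeff_mk] using hv
  ext k
  have hk : PowerSeries.coeff k P = 0 := by rw [hP0, map_zero]
  rw [hP, PowerSeries.coeff_mk] at hk
  rw [map_zero]
  exact_mod_cast hk

/-- **The torsion-point identity principle for `𝒪_{ℂ_p}⟦T⟧`, agreement form**: two series taking the same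
value at `ζ − 1` for every primitive `pⁿ`-th root of unity `ζ` of every level `n > n₀` are equal.
[cite: Washington1997, §12.2] [cite: deShalit1987, I.3.3 (8) (p. 17)] -/
theorem eq_of_forall_hasValueAt_torsion_eq {Q Q' : PowerSeries (PadicComplexInt p)} (n₀ : ℕ)
    (h : ∀ (n : ℕ) (ζ : ℂ_[p]), n₀ < n → IsPrimitiveRoot ζ (p ^ n) →
      ∃ v : ℂ_[p], IntSeries.HasValueAt Q (ζ - 1) v ∧ IntSeries.HasValueAt Q' (ζ - 1) v) : Q = Q' := by
  refine sub_eq_zero.mp (eq_zero_of_forall_hasValueAt_torsion_zero n₀ fun n ζ hn hζ ↦ ?_)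
  obtain ⟨v, hv, hv'⟩ := h n ζ hn hζ
  simpa using hv.sub hv'

/-! ### §3. Two variables: lines `T₁ = c` with torsion zeros, and the fibred principles -/

/-- The torsion points lie in the open unit disc: `‖ζ − 1‖ < 1` for a primitive `pⁿ`-th root of unity
`ζ ∈ ℂ_p`. [cite: Washington1997, §7.2] -/
theorem norm_sub_one_lt_one_of_isPrimitiveRoot_pow {ζ : ℂ_[p]} {n : ℕ} (hζ : IsPrimitiveRoot ζ (p ^ n)) :
    ‖ζ - 1‖ < 1 :=
  norm_sub_one_lt_one_of_pow_prime_pow_eq_one hζ.pow_eq_one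

/-- **A line with torsion zeros vanishes**: if `‖c‖ < 1` and `G(c, ζ − 1) = 0` for every primitive
`pⁿ`-th root of unity `ζ` of every level `n > n₀`, then `lineSubst c G = 0`.
[cite: deShalit1987, II.4.17 (54) (p. 78)] [cite: Washington1997, §12.2] -/
theorem lineSubst_eq_zero_of_torsion_zeros (G : PowerSeries (PowerSeries (PadicComplexInt p)))
    {c : PadicComplexInt p} (hc : ‖(c : ℂ_[p])‖ < 1) (n₀ : ℕ)
    (h : ∀ (n : ℕ) (ζ : ℂ_[p]), n₀ < n → IsPrimitiveRoot ζ (p ^ n) →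
      IntSeries.HasValueAt₂ G c (ζ - 1) 0) : lineSubst c G = 0 :=
  eq_zero_of_forall_hasValueAt_torsion_zero n₀ fun n ζ hn hζ ↦
    (hasValueAt_lineSubst_iff G hc (norm_sub_one_lt_one_of_isPrimitiveRoot_pow hζ) 0).mpr (h n ζ hn hζ)

/-- **The identity principle for `𝒪_{ℂ_p}⟦T₁⟧⟦T₂⟧` with TORSION second coordinates (fibred zeros form).**
Let `D₁ ⊆ 𝒪_{ℂ_p}` be an infinite subset of a closed disc `‖c‖ ≤ ‖ϖ‖`, `0 < ‖ϖ‖ < 1`, and suppose that for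
every `c ∈ D₁` the line `T₁ = c` vanishes at the torsion points of large order: `G(c, ζ − 1) = 0` for every
primitive `pⁿ`-th root of unity `ζ`, `n > n₀(c)`. Then `G = 0`: each such line is `0`
(`lineSubst_eq_zero_of_torsion_zeros`), so each coefficient series `[T₂^k]Gᵗ` has the infinitely many zeros
`D₁` in the closed disc (`IntSeries.eq_zero_of_infinite_zeros`). This is the shape of the interpolation set
of de Shalit's two-variable measure on the infinity types `(−m, 0)` (first coordinate `u^{−m} − 1`, second
coordinate `ζ − 1`). [cite: deShalit1987, II.4.17 (51)–(54) (p. 77–78)] [cite: Washington1997, §12.2] [cite: Gouvea1993PadicNumbers, §5.6 Cor. 5.6.4] -/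
theorem eq_zero_of_zeros₂_fibred_torsion {G : PowerSeries (PowerSeries (PadicComplexInt p))}
    {ϖ : ℂ_[p]} (hϖ0 : ϖ ≠ 0) (hϖ : ‖ϖ‖ < 1) {D₁ : Set (PadicComplexInt p)} (hD₁ : D₁.Infinite)
    (hD₁ϖ : ∀ c ∈ D₁, ‖(c : ℂ_[p])‖ ≤ ‖ϖ‖)
    (h : ∀ c ∈ D₁, ∃ n₀ : ℕ, ∀ (n : ℕ) (ζ : ℂ_[p]), n₀ < n → IsPrimitiveRoot ζ (p ^ n) →
      IntSeries.HasValueAt₂ G c (ζ - 1) 0) : G = 0 := by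
  -- every line `T₁ = c`, `c ∈ D₁`, vanishes
  have hline : ∀ c ∈ D₁, lineSubst c G = 0 := fun c hc ↦ by
    obtain ⟨n₀, hn₀⟩ := h c hc
    exact lineSubst_eq_zero_of_torsion_zeros G ((hD₁ϖ c hc).trans_lt hϖ) n₀ hn₀
  -- hence every coefficient series of the transpose vanishes on `D₁`
  have hcoeff : ∀ k : ℕ, PowerSeries.coeff k (transpose G) = 0 := by
    intro k
    refine eq_zero_of_infinite_zeros hϖ0 hϖ ((hD₁.image Subtype.coe_injective.injOn).mono ?_)
    rintro x ⟨c, hc, rfl⟩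
    refine ⟨hD₁ϖ c hc, ?_⟩
    have hv := hasValueAt_coeff_transpose G ((hD₁ϖ c hc).trans_lt hϖ) k
    rw [hline c hc, map_zero] at hv
    simpa using hv
  have ht : transpose G = 0 := PowerSeries.ext fun k ↦ by rw [hcoeff k, map_zero]
  calc G = transpose (transpose G) := (transpose_transpose G).symm
    _ = transpose 0 := by rw [ht]
    _ = 0 := by ext i j; simp

/-- **Agreement form** of `eq_zero_of_zeros₂_fibred_torsion`: if for every `c` in an infinite subset `D₁`
of a closed disc `‖c‖ ≤ ‖ϖ‖ < 1` the series `G`, `G'` take a common value at `(c, ζ − 1)` for every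
primitive `pⁿ`-th root of unity `ζ` of every level `n > n₀(c)`, then `G = G'`.
[cite: deShalit1987, II.4.17 (51)–(54) (p. 77–78)] [cite: Washington1997, §12.2] -/
theorem eq_of_hasValueAt₂_eq_fibred_torsion {G G' : PowerSeries (PowerSeries (PadicComplexInt p))}
    {ϖ : ℂ_[p]} (hϖ0 : ϖ ≠ 0) (hϖ : ‖ϖ‖ < 1) {D₁ : Set (PadicComplexInt p)} (hD₁ : D₁.Infinite)
    (hD₁ϖ : ∀ c ∈ D₁, ‖(c : ℂ_[p])‖ ≤ ‖ϖ‖)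
    (h : ∀ c ∈ D₁, ∃ n₀ : ℕ, ∀ (n : ℕ) (ζ : ℂ_[p]), n₀ < n → IsPrimitiveRoot ζ (p ^ n) →
      ∃ v : ℂ_[p], IntSeries.HasValueAt₂ G c (ζ - 1) v ∧ IntSeries.HasValueAt₂ G' c (ζ - 1) v) :
    G = G' := by
  refine sub_eq_zero.mp (eq_zero_of_zeros₂_fibred_torsion hϖ0 hϖ hD₁ hD₁ϖ fun c hc ↦ ?_)
  obtain ⟨n₀, hn₀⟩ := h c hc
  refine ⟨n₀, fun n ζ hn hζ ↦ ?_⟩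
  obtain ⟨v, hv, hv'⟩ := hn₀ n ζ hn hζ
  simpa using hv.sub hv'

/-- **The transposed orientation**: if `G(ζ − 1, y) = 0` for every primitive `pⁿ`-th root of unity `ζ` of
every level `n > n₀` and every `y` in an infinite subset `D₂ ⊆ 𝒪_{ℂ_p}` of a closed disc `‖y‖ ≤ ‖ϖ‖ < 1`,
then `G = 0` (apply the fibred form to `Gᵗ`, `hasValueAt₂_transpose_iff`).
[cite: deShalit1987, II.4.17 (51)–(54) (p. 77–78)] [cite: Washington1997, §12.2] -/
theorem eq_zero_of_zeros₂_torsion_fst {G : PowerSeries (PowerSeries (PadicComplexInt p))}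
    {ϖ : ℂ_[p]} (hϖ0 : ϖ ≠ 0) (hϖ : ‖ϖ‖ < 1) {D₂ : Set (PadicComplexInt p)} (hD₂ : D₂.Infinite)
    (hD₂ϖ : ∀ y ∈ D₂, ‖(y : ℂ_[p])‖ ≤ ‖ϖ‖) (n₀ : ℕ)
    (h : ∀ (n : ℕ) (ζ : ℂ_[p]), n₀ < n → IsPrimitiveRoot ζ (p ^ n) → ∀ y ∈ D₂,
      IntSeries.HasValueAt₂ G (ζ - 1) y 0) : G = 0 := by
  have ht : transpose G = 0 :=
    eq_zero_of_zeros₂_fibred_torsion hϖ0 hϖ hD₂ hD₂ϖ fun y hy ↦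
      ⟨n₀, fun n ζ hn hζ ↦ (hasValueAt₂_transpose_iff G y (ζ - 1) 0).mpr (h n ζ hn hζ y hy)⟩
  calc G = transpose (transpose G) := (transpose_transpose G).symm
    _ = transpose 0 := by rw [ht]
    _ = 0 := by ext i j; simp

/-- **Both coordinates torsion**: if `G(ζ − 1, ξ − 1) = 0` for all primitive `pⁿ`-th roots `ζ` (levels
`n > n₀`) and all primitive `p^m`-th roots `ξ` (levels `m > m₀`), then `G = 0`: every line `T₁ = ζ − 1`
vanishes (`lineSubst_eq_zero_of_torsion_zeros`), so each coefficient series of `Gᵗ` vanishes at the torsion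
points `ζ − 1` and is `0` by the one-variable principle again.
[cite: deShalit1987, II.4.17 (51)–(54) (p. 77–78)] [cite: Washington1997, §12.2] -/
theorem eq_zero_of_zeros₂_torsion_torsion {G : PowerSeries (PowerSeries (PadicComplexInt p))} (n₀ m₀ : ℕ)
    (h : ∀ (n : ℕ) (ζ : ℂ_[p]), n₀ < n → IsPrimitiveRoot ζ (p ^ n) →
      ∀ (m : ℕ) (ξ : ℂ_[p]), m₀ < m → IsPrimitiveRoot ξ (p ^ m) →
        IntSeries.HasValueAt₂ G (ζ - 1) (ξ - 1) 0) : G = 0 := by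
  -- the torsion points as elements of `𝒪_{ℂ_p}`
  have hmem : ∀ {ζ : ℂ_[p]} {n : ℕ}, IsPrimitiveRoot ζ (p ^ n) → ζ - 1 ∈ PadicComplexInt p :=
    fun hζ ↦ mem_padicComplexInt_iff.mpr (norm_sub_one_lt_one_of_isPrimitiveRoot_pow hζ).le
  -- every line `T₁ = ζ − 1` vanishes
  have hline : ∀ (n : ℕ) (ζ : ℂ_[p]) (hn : n₀ < n) (hζ : IsPrimitiveRoot ζ (p ^ n)),
      lineSubst ⟨ζ - 1, hmem hζ⟩ G = 0 := fun n ζ hn hζ ↦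
    lineSubst_eq_zero_of_torsion_zeros G (norm_sub_one_lt_one_of_isPrimitiveRoot_pow hζ) m₀
      fun m ξ hm hξ ↦ h n ζ hn hζ m ξ hm hξ
  -- hence every coefficient series of the transpose vanishes at the torsion points `ζ − 1`
  have hcoeff : ∀ k : ℕ, PowerSeries.coeff k (transpose G) = 0 := by
    intro k
    refine eq_zero_of_forall_hasValueAt_torsion_zero n₀ fun n ζ hn hζ ↦ ?_
    have hv := hasValueAt_coeff_transpose G (c := ⟨ζ - 1, hmem hζ⟩)
      (norm_sub_one_lt_one_of_isPrimitiveRoot_pow hζ) k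
    rw [hline n ζ hn hζ, map_zero] at hv
    simpa using hv
  have ht : transpose G = 0 := PowerSeries.ext fun k ↦ by rw [hcoeff k, map_zero]
  calc G = transpose (transpose G) := (transpose_transpose G).symm
    _ = transpose 0 := by rw [ht]
    _ = 0 := by ext i j; simp

end IntSeries

end Literature.NumberTheory.EllipticCurves

end
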